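import Summits.CriticalPhenomena.PercolationContinuityZ3.Theorems.PercNearOneGluingNoHeavyLowerTailCILEdgeRaising
import HarnessLib

/-!
# `NoHeavyLowerTail` (stmt-CriticalPhenomena-4575) — edge raising at the observer set as an IDENTITY

Support file (prover `prim-gen-induct`; `--supports stmt-CriticalPhenomena-4575`).  No definitions, no named facts, no sorries.

Notation as in `…CILEdgeRaising`: `μ_w = prodBernoulli w` on `Fin n`, relays `A`, level `j`, observer set `S`, witness `c`,
`L_w(S, c) = μ_w(c ↮ S, 1 ≤ |π(S)| ≤ j)` and `R_w(S, c) = μ_w(c ↮ S, |π(c)| ≤ j)` (so `CS_w(S,c)` is `L ≤ R`).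

`setCS_raise_edge` (tree) raises one pair `e = s(v,y)`, `v ∈ S`, as an INEQUALITY.  The flat form of the induction step (crux notes,
BLOBQUOTIENT.md §18: `Λ_w(S,c) = Σ_Y P(Y)·Λ_{w−S}(S ∪ Y, c)`, summed with configuration-dependent certified witnesses) needs the
underlying IDENTITIES, which this file records: with `w₀ = w[e ↦ 0]`,

* `CutObserver.real_setL_raise_edge` : `L_w(S, c) = (1 − w e)·L_{w₀}(S, c) + (w e)·L_{w₀}(S ∪ {y}, c)`,
* `CutObserver.real_setR_raise_edge` : `R_w(S, c) = (1 − w e)·R_{w₀}(S, c) + (w e)·R_{w₀}(S ∪ {y}, c)`   (`y ≠ v`; for `y ∈ S` both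
  right-hand events coincide with the left ones),

by the one-bond decomposition (`stub_oneBondDecomp_k15`) and the gluing lemmas of `…ChampionStability` exactly as in the tree proof
of `setCS_raise_edge`.  Hence `Λ_w(S,c) := R_w − L_w` is affine in each pair at `S` with the displayed coefficients.
-/

noncomputable section

namespace Summit.CriticalPhenomena.PercolationContinuityZ3.Theorems

open MeasureTheory Set Literature.Probability.LatticeModels Literature.Probability.Percolation
open scoped Classical BigOperators

variable {n : ℕ}

namespace CutObserver

open ChampionStability

/-- **Raising one edge at the observer set, left event, as an identity**: for `v ∈ S`, `y ≠ v`, `e = s(v,y)`, `w₀ = w[e↦0]`,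
`μ_w(c ↮ S, 1 ≤ |π(S)| ≤ j) = (1 − w e)·μ_{w₀}(c ↮ S, 1 ≤ |π(S)| ≤ j) + (w e)·μ_{w₀}(c ↮ S ∪ {y}, 1 ≤ |π(S ∪ {y})| ≤ j)`.
[folklore] -/
theorem real_setL_raise_edge (w : Sym2 (Fin n) → unitInterval) (A S : Finset (Fin n)) (v y c : Fin n) (j : ℕ)
    (hvS : v ∈ S) (hvy : v ≠ y) :
    (prodBernoulli w).real {ω : BondConfig (Fin n) |
        (∀ x ∈ S, ω ∉ openConn c x) ∧ 1 ≤ (A.filter fun z => ∃ x ∈ S, ω ∈ openConn x z).card ∧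
        (A.filter fun z => ∃ x ∈ S, ω ∈ openConn x z).card ≤ j} =
      (1 - (w s(v, y) : ℝ)) * (prodBernoulli (Function.update w s(v, y) 0)).real {ω : BondConfig (Fin n) |
        (∀ x ∈ S, ω ∉ openConn c x) ∧ 1 ≤ (A.filter fun z => ∃ x ∈ S, ω ∈ openConn x z).card ∧
        (A.filter fun z => ∃ x ∈ S, ω ∈ openConn x z).card ≤ j} +
      (w s(v, y) : ℝ) * (prodBernoulli (Function.update w s(v, y) 0)).real {ω : BondConfig (Fin n) |
        (∀ x ∈ insert y S, ω ∉ openConn c x) ∧ 1 ≤ (A.filter fun z => ∃ x ∈ insert y S, ω ∈ openConn x z).card ∧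
        (A.filter fun z => ∃ x ∈ insert y S, ω ∈ openConn x z).card ≤ j} := by
  set e : Sym2 (Fin n) := s(v, y) with he
  set w₀ := Function.update w e 0 with hw₀
  set LS := {ω : BondConfig (Fin n) |
    (∀ x ∈ S, ω ∉ openConn c x) ∧ 1 ≤ (A.filter fun z => ∃ x ∈ S, ω ∈ openConn x z).card ∧
    (A.filter fun z => ∃ x ∈ S, ω ∈ openConn x z).card ≤ j} with hLS
  set LSy := {ω : BondConfig (Fin n) |
    (∀ x ∈ insert y S, ω ∉ openConn c x) ∧ 1 ≤ (A.filter fun z => ∃ x ∈ insert y S, ω ∈ openConn x z).card ∧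
    (A.filter fun z => ∃ x ∈ insert y S, ω ∈ openConn x z).card ≤ j} with hLSy
  have hw₀e : w₀ s(v, y) = 0 := by simp [hw₀, he]
  have hw₁ : Function.update w e 1 = Function.update w₀ s(v, y) 1 := by
    rw [hw₀, he, Function.update_idem]
  have hfilt : ∀ ω : BondConfig (Fin n),
      (A.filter fun z => ∃ x ∈ S, insert s(v, y) ω ∈ openConn x z) =
        (A.filter fun z => ∃ x ∈ insert y S, ω ∈ openConn x z) := by
    intro ω
    exact Finset.filter_congr fun z _ => exists_reachable_insert_iff ω hvy hvS z
  have hpreL : (fun ω : BondConfig (Fin n) => insert s(v, y) ω) ⁻¹' LS = LSy := by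
    ext ω
    simp only [hLS, hLSy, mem_preimage, mem_setOf_eq]
    rw [hfilt ω]
    constructor
    · rintro ⟨hsep, h1, h2⟩
      exact ⟨(forall_not_reachable_insert_iff ω hvy hvS).1 hsep, h1, h2⟩
    · rintro ⟨hsep, h1, h2⟩
      exact ⟨(forall_not_reachable_insert_iff ω hvy hvS).2 hsep, h1, h2⟩
  have hL1 : (prodBernoulli (Function.update w e 1)).real LS = (prodBernoulli w₀).real LSy := by
    rw [hw₁, real_update_one_eq w₀ hw₀e LS, hpreL]
  rw [stub_oneBondDecomp_k15 n w e LS, hL1]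

/-- **Raising one edge at the observer set, right event, as an identity**: for `v ∈ S`, `y ≠ v`, `e = s(v,y)`, `w₀ = w[e↦0]`,
`μ_w(c ↮ S, |π(c)| ≤ j) = (1 − w e)·μ_{w₀}(c ↮ S, |π(c)| ≤ j) + (w e)·μ_{w₀}(c ↮ S ∪ {y}, |π(c)| ≤ j)`. [folklore] -/
theorem real_setR_raise_edge (w : Sym2 (Fin n) → unitInterval) (A S : Finset (Fin n)) (v y c : Fin n) (j : ℕ)
    (hvS : v ∈ S) (hvy : v ≠ y) :
    (prodBernoulli w).real {ω : BondConfig (Fin n) |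
        (∀ x ∈ S, ω ∉ openConn c x) ∧ (A.filter fun z => ω ∈ openConn c z).card ≤ j} =
      (1 - (w s(v, y) : ℝ)) * (prodBernoulli (Function.update w s(v, y) 0)).real {ω : BondConfig (Fin n) |
        (∀ x ∈ S, ω ∉ openConn c x) ∧ (A.filter fun z => ω ∈ openConn c z).card ≤ j} +
      (w s(v, y) : ℝ) * (prodBernoulli (Function.update w s(v, y) 0)).real {ω : BondConfig (Fin n) |
        (∀ x ∈ insert y S, ω ∉ openConn c x) ∧ (A.filter fun z => ω ∈ openConn c z).card ≤ j} := by
  set e : Sym2 (Fin n) := s(v, y) with he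
  set w₀ := Function.update w e 0 with hw₀
  set RS := {ω : BondConfig (Fin n) |
    (∀ x ∈ S, ω ∉ openConn c x) ∧ (A.filter fun z => ω ∈ openConn c z).card ≤ j} with hRS
  set RSy := {ω : BondConfig (Fin n) |
    (∀ x ∈ insert y S, ω ∉ openConn c x) ∧ (A.filter fun z => ω ∈ openConn c z).card ≤ j} with hRSy
  have hw₀e : w₀ s(v, y) = 0 := by simp [hw₀, he]
  have hw₁ : Function.update w e 1 = Function.update w₀ s(v, y) 1 := by
    rw [hw₀, he, Function.update_idem]
  have hfiltc : ∀ ω : BondConfig (Fin n), (∀ x ∈ insert y S, ω ∉ openConn c x) →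
      (A.filter fun z => insert s(v, y) ω ∈ openConn c z) = (A.filter fun z => ω ∈ openConn c z) := by
    intro ω h
    have hcv : ¬ (openGraph ω).Reachable c v := h v (Finset.mem_insert_of_mem hvS)
    have hcy : ¬ (openGraph ω).Reachable c y := h y (Finset.mem_insert_self _ _)
    exact Finset.filter_congr fun z _ => reachable_insert_iff_of_not ω hvy hcv hcy z
  have hpreR : (fun ω : BondConfig (Fin n) => insert s(v, y) ω) ⁻¹' RS = RSy := by
    ext ω
    simp only [hRS, hRSy, mem_preimage, mem_setOf_eq]
    constructor
    · rintro ⟨hsep, h2⟩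
      have hsep' := (forall_not_reachable_insert_iff ω hvy hvS).1 hsep
      refine ⟨hsep', ?_⟩
      rw [← hfiltc ω hsep']; exact h2
    · rintro ⟨hsep, h2⟩
      refine ⟨(forall_not_reachable_insert_iff ω hvy hvS).2 hsep, ?_⟩
      rw [hfiltc ω hsep]; exact h2
  have hR1 : (prodBernoulli (Function.update w e 1)).real RS = (prodBernoulli w₀).real RSy := by
    rw [hw₁, real_update_one_eq w₀ hw₀e RS, hpreR]
  rw [stub_oneBondDecomp_k15 n w e RS, hR1]

end CutObserver

end Summit.CriticalPhenomena.PercolationContinuityZ3.Theorems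

end
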